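import Summits.BirchSwinnertonDyer.Rank1Residual.X11b.BDPRouteNonsingularPart
import HarnessLib

/-!
# Class X11b, route p2: the subgroup `M₀` of points with non-singular reduction —
# (g4) `[E(K̄)^{D_v} : E(K̄)^{D_v} ⊓ M₀] ∣ c_v`, and finiteness of the `K_v`-rational `p`-power torsion
# (cell `b2b-bsdres`, sub-cell `multr1-p2`, gen 14)

HONEST FRAMING (verbatim, cell `b2b-bsdres`): the goal of the cell is to DELETE the
COMBINATION-SHAPED residual classes for ALL analytic-rank `≤ 1` curves over `ℚ` — "full BSD
formula for every rank `≤ 1` curve in class `C`" assembled STRICTLY from published theorems — so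
that the rank-`≤ 1` remainder becomes exactly the CONSTRUCTION-SHAPED classes, which are TYPED
(missing-input Props), NOT attempted; this is not "finishing BSD". Research route `p2` for class
X11b; no claim beyond the stated class; nothing booked; X11b stays CONSTRUCTION-SHAPED. Theorems
only; no definition, no named fact, no `sorry`. Continues `BDPRouteNonsingularPart.lean`.

## Content

* **`relIndex_nonsingularPart_ker_dvd_localTamagawaNumber`** (g4) — for an arithmetic Frobenius
  `φ ∈ D_v` at `𝔓₀`, the index of `M₀ ⊓ E(K̄)^{D_v}` in `E(K̄)^{D_v} = ker (φ − 1)` DIVIDES the local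
  Tamagawa number `c_v = [X(K_v) : X₀(K_v)]`: a `D_v`-fixed point `P` has `F P ∈ X(K̄_v)` fixed by
  `Γ_{K_v}`, hence `F P` comes from a `K_v`-rational point `d P ∈ X(K_v)` (Galois descent,
  `exists_point_map_eq_of_forall_map_eq`); `P ↦ d P` is a homomorphism with
  `d P ∈ X₀(K_v) ↔ P ∈ M₀` (`hasNonsingularReduction_algebraMap_iff`), so
  `E(K̄)^{D_v}/(E(K̄)^{D_v} ⊓ M₀) ↪ X(K_v)/X₀(K_v)`, a group of order `c_v`
  (`localTamagawaNumber_eq_index_nonsingularReductionSubgroup`; Lagrange).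
* **`finite_setOf_smul_decomp_eq_of_isPrimary`** — for `v ∤ p` the `D_v`-fixed `p`-power torsion
  points of `E(K̄)` form a finite set (they map injectively to the `Γ_{K_v}`-fixed `p`-power torsion
  of `X(K̄_v)`, finite by the tree's `finite_setOf_forall_map_eq_and_nsmul_eq_zero`: Silverman *AEC*
  VII.3.1 + Cor. VII.6.2 over `𝓞_v`) — the hypothesis `hfin` of
  `natCard_localKer_le_pow_padicValNat_relIndex_of_divisible` (Greenberg: "the kernel of `γ_v − 1`
  on `B_v` is `E(F_v)_p`, a finite group", p. 87).

CONDITIONAL use only; nothing booked; reach and labels unchanged.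

References: [SilvermanAEC2009] VII.§2, VII.3.1, §VII.6 (Ex. 7.6), VIII.§1; [GreenbergLNM1716] §3
Lemma 3.3 (p. 87), §4 proof of Thm. 4.1 (p. 74); [NeukirchANT1999] II §9 (9.6).
-/

noncomputable section

open scoped Classical NNReal

open NumberField IsDedekindDomain Field IsDedekindDomain.HeightOneSpectrum WeierstrassCurve
open Literature.NumberTheory.EllipticCurves Literature.NumberTheory.EllipticCurves.GreenbergSelmer
open Literature.NumberTheory.GaloisRepresentations

universe u

namespace Summit.BirchSwinnertonDyer.Rank1Residual.X11b.AcSelmer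

variable {K : Type u} [Field K] [NumberField K] {W : WeierstrassCurve K} {v : HeightOneSpectrum (𝓞 K)}
  {w : Valuation (AlgebraicClosure (v.adicCompletion K)) ℝ≥0}
  (hw : ∀ x, (w x : ℝ) =
    spectralNorm (v.adicCompletion K) (AlgebraicClosure (v.adicCompletion K)) x)
  {W₀ : WeierstrassCurve w.integer}
  (hW₀ : ((W.localMinimalIntegralModel v).map (algebraMap (v.adicCompletionIntegers K)
      (v.adicCompletion K))).baseChange (AlgebraicClosure (v.adicCompletion K)) =
    W₀.baseChange (AlgebraicClosure (v.adicCompletion K)))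
  {Φ : localPoints W (v.adicCompletion K) ≃+
    (((W.localMinimalIntegralModel v).map (algebraMap (v.adicCompletionIntegers K)
      (v.adicCompletion K))).baseChange (AlgebraicClosure (v.adicCompletion K))).toAffine.Point}
  (hΦ : ∀ (σ : absoluteGaloisGroup (v.adicCompletion K)) (Q : localPoints W (v.adicCompletion K)),
    Φ (σ • Q) = Affine.Point.map ((absoluteGaloisGroup.toAlgEquiv _ σ :
        AlgebraicClosure (v.adicCompletion K) ≃ₐ[v.adicCompletion K]
          AlgebraicClosure (v.adicCompletion K)) :
        AlgebraicClosure (v.adicCompletion K) →ₐ[v.adicCompletion K]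
          AlgebraicClosure (v.adicCompletion K)) (Φ Q))

/-! ## (g4) The index of `M₀` in the `D_v`-fixed points divides `c_v` -/

section Index

include hw hΦ in
/-- **(g4) `[E(K̄)^{D_v} : E(K̄)^{D_v} ⊓ M₀] ∣ c_v`.** For an arithmetic Frobenius `φ ∈ D_v` at the
chosen `𝔓₀ ∣ v`, `ker (φ − 1) = E(K̄)^{D_v}` (`inertiaSubOne_eq_zero_iff`), and the relative index of
`M₀ = nonsingularPart` in it divides the local Tamagawa number `c_v(E/K) = [X(K_v) : X₀(K_v)]` on the
minimal model: `D_v`-fixed points descend to `X(K_v)` (`exists_point_map_eq_of_forall_map_eq`),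
additively and injectively, with `M₀` corresponding to `X₀(K_v)` (`hasNonsingularReduction_algebraMap_iff`);
so `E(K̄)^{D_v}/(E(K̄)^{D_v} ⊓ M₀)` is a subgroup of `X(K_v)/X₀(K_v)` (Lagrange). Greenberg: "the
index … is `c_v`" (proof of Thm. 4.1, p. 74). [cite: GreenbergLNM1716, §3 Lemma 3.3 (p. 87) and §4 proof of Thm. 4.1 (p. 74)]
[cite: SilvermanAEC2009, §VII.6 (Ex. 7.6, `c_v = [E(K_v):E₀(K_v)]`) and VIII.§1] -/
theorem relIndex_nonsingularPart_ker_dvd_localTamagawaNumber [W.IsElliptic]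
    {φ : absoluteGaloisGroup K} (hφ : IsArithFrobAt (𝓞 K) φ (adicCompletionPrime K v))
    (hφD : φ ∈ decomp v) :
    (nonsingularPart W hW₀ Φ).relIndex (inertiaSubOne W.geomPoints φ hφD).ker ∣
      (W.baseChange (v.adicCompletion K)).localTamagawaNumber (v.adicCompletionIntegers K) := by
  -- notation
  let X := (W.localMinimalIntegralModel v).map (algebraMap (v.adicCompletionIntegers K)
    (v.adicCompletion K))
  haveI : X.IsElliptic := W.isElliptic_map_localMinimalIntegralModel (v := v)
  obtain ⟨𝔐, h𝔐⟩ := v.localPrimesAbove_nonempty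
  let Fix := FixedPoints.addSubgroup ↥((adicCompletionPrime K v).inertia (absoluteGaloisGroup K))
    W.geomPoints
  let M₀ : AddSubgroup Fix := nonsingularPart W hW₀ Φ
  let D : AddSubgroup Fix := (inertiaSubOne W.geomPoints φ hφD).ker
  let E₀K := (W.localMinimalIntegralModel v).nonsingularReductionSubgroup
    (integers_valuationRing_valuation (v.adicCompletionIntegers K) (v.adicCompletion K))
  let ι := closureEmb (K := K) (v.adicCompletion K)
  have hXid : X.baseChange (v.adicCompletion K) = X := by
    change X.map (algebraMap (v.adicCompletion K) (v.adicCompletion K)) = X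
    rw [Algebra.algebraMap_self, WeierstrassCurve.map_id]
  -- `D_v`-fixed points have `Γ_{K_v}`-fixed images
  have hDfix : ∀ P : D, ∀ x ∈ decomp v, x • ((P : Fix) : W.geomPoints) = ((P : Fix) : W.geomPoints) :=
    fun P ↦ (inertiaSubOne_eq_zero_iff W hφ hφD (P : Fix)).mp ((AddMonoidHom.mem_ker).mp P.2)
  have hfixD : ∀ (P : D) (σ : absoluteGaloisGroup (v.adicCompletion K)),
      Affine.Point.map ((absoluteGaloisGroup.toAlgEquiv _ σ :
          AlgebraicClosure (v.adicCompletion K) ≃ₐ[v.adicCompletion K]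
            AlgebraicClosure (v.adicCompletion K)) :
          AlgebraicClosure (v.adicCompletion K) →ₐ[v.adicCompletion K]
            AlgebraicClosure (v.adicCompletion K))
        (Φ (pointsMapOfEmb W ι ((P : Fix) : W.geomPoints))) =
        Φ (pointsMapOfEmb W ι ((P : Fix) : W.geomPoints)) := by
    intro P σ
    rw [← transport_pointsMapOfEmb_smul hΦ]
    congr 2
    exact hDfix P _ (resGalOfEmb_closureEmb_mem_decomp v σ)
  -- Galois descent: `F P = (d₀ P)_{K̄_v}` with `d₀ P ∈ X(K_v)`
  have hdesc : ∀ P : D, ∃ R : (X.baseChange (v.adicCompletion K)).toAffine.Point,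
      Affine.Point.map (W' := X)
        (Algebra.ofId (v.adicCompletion K) (AlgebraicClosure (v.adicCompletion K))) R =
        Φ (pointsMapOfEmb W ι ((P : Fix) : W.geomPoints)) :=
    fun P ↦ exists_point_map_eq_of_forall_map_eq X (hfixD P)
  choose d₀ hd₀ using hdesc
  have hinj := Affine.Point.map_injective (W' := X)
    (Algebra.ofId (v.adicCompletion K) (AlgebraicClosure (v.adicCompletion K)))
  have hd₀_zero : d₀ 0 = 0 := hinj (by
    rw [hd₀, map_zero]
    change Φ (pointsMapOfEmb W ι (0 : W.geomPoints)) = 0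
    rw [map_zero, map_zero])
  have hd₀_add : ∀ P Q : D, d₀ (P + Q) = d₀ P + d₀ Q := fun P Q ↦ hinj (by
    rw [map_add, hd₀, hd₀, hd₀]
    change Φ (pointsMapOfEmb W ι (((P : Fix) : W.geomPoints) + ((Q : Fix) : W.geomPoints))) = _
    rw [map_add, map_add])
  -- the homomorphism `d : D → X(K_v)`
  let d : D →+ ((W.localMinimalIntegralModel v).baseChange (v.adicCompletion K)).toAffine.Point :=
    { toFun := fun P ↦ Affine.Point.congrEquiv hXid (d₀ P)
      map_zero' := by
        change Affine.Point.congrEquiv hXid (d₀ 0) = 0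
        rw [hd₀_zero, map_zero]
      map_add' := fun P Q ↦ by
        change Affine.Point.congrEquiv hXid (d₀ (P + Q)) =
          Affine.Point.congrEquiv hXid (d₀ P) + Affine.Point.congrEquiv hXid (d₀ Q)
        rw [hd₀_add, map_add] }
  have hd : ∀ P : D, d P = Affine.Point.congrEquiv hXid (d₀ P) := fun _ ↦ rfl
  -- `d P ∈ X₀(K_v) ↔ P ∈ M₀`
  have hbridge : ∀ P : D, d P ∈ E₀K ↔ (P : Fix) ∈ M₀ := by
    intro P
    rw [mem_nonsingularReductionSubgroup_iff, mem_nonsingularPart_iff, hd, ← hd₀ P]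
    obtain hR0 | ⟨x₀, y₀, hxy, hR⟩ : d₀ P = 0 ∨ ∃ x₀ y₀ h, d₀ P = .some x₀ y₀ h := by
      rcases d₀ P with _ | ⟨x, y, h⟩
      exacts [Or.inl rfl, Or.inr ⟨x, y, h, rfl⟩]
    · rw [hR0, map_zero, map_zero, map_zero]
      exact iff_of_true WeierstrassCurve.hasNonsingularReduction_zero
        WeierstrassCurve.hasNonsingularReduction_zero
    · rw [hR, Affine.Point.congrEquiv_some, Affine.Point.map_some, Affine.Point.congrEquiv_some]
      exact (hasNonsingularReduction_algebraMap_iff hw (W.localMinimalIntegralModel v) h𝔐 hW₀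
        _ _).symm
  -- `δ : D → X(K_v)/X₀(K_v)` has kernel `D ⊓ M₀`
  let δ : D →+ _ ⧸ E₀K := (QuotientAddGroup.mk' E₀K).comp d
  have hker : δ.ker = M₀.addSubgroupOf D := by
    ext P
    rw [AddMonoidHom.mem_ker, AddSubgroup.mem_addSubgroupOf, AddMonoidHom.comp_apply,
      QuotientAddGroup.mk'_apply, QuotientAddGroup.eq_zero_iff, hbridge]
  -- index bookkeeping
  have h1 : M₀.relIndex D = δ.ker.index := by rw [hker]; rfl
  rw [h1, AddSubgroup.index_ker, localTamagawaNumber_eq_index_nonsingularReductionSubgroup]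
  exact AddSubgroup.card_addSubgroup_dvd_card δ.range

end Index

/-! ## Finiteness of the `D_v`-fixed `p`-power torsion (`E(K_v)[p^∞]` is finite) -/

section Finite

variable (W)

/-- **The `D_v`-fixed `p`-power torsion of `E(K̄)` is finite for `v ∤ p`** (it is the `p`-power
torsion of `E(K_v)`): along an equivariant transport `Φ ∘ ι_*` to the minimal model these points are
`Γ_{K_v}`-fixed `p`-power torsion points of `X(K̄_v)`, a finite set by the tree's
`finite_setOf_forall_map_eq_and_nsmul_eq_zero` (Silverman *AEC* VII.3.1: `E₁(K_v)` has no `p`-torsion;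
Cor. VII.6.2: `[X(K_v) : E₁(K_v)] < ∞`). Greenberg: "the kernel of `γ_v − 1` acting on `B_v` … is
finite" (p. 87). [cite: GreenbergLNM1716, §3 Lemma 3.3 (proof, p. 87)]
[cite: SilvermanAEC2009, Prop. VII.3.1 and Cor. VII.6.2] -/
theorem finite_setOf_smul_decomp_eq_of_isPrimary [W.IsElliptic] (p : ℕ)
    (hpv : (p : 𝓞 K) ∉ v.asIdeal) :
    Set.Finite {m : W.geomPoints | (∀ x ∈ decomp v, x • m = m) ∧ ∃ k : ℕ, p ^ k • m = 0} := by
  obtain ⟨w, hw⟩ := v.exists_spectralValuation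
  obtain ⟨C, hC⟩ := W.exists_variableChange_eq_localMinimalIntegralModel v
  obtain ⟨Φ, hΦ⟩ := W.exists_addEquiv_localPoints_of_smul_eq v hC
  let ι := closureEmb (K := K) (v.adicCompletion K)
  have hp : IsUnit ((p : ℕ) : v.adicCompletionIntegers K) := by
    have h := isUnit_algebraMap_adicCompletionIntegers K v hpv
    rwa [map_natCast] at h
  have hS := W.finite_setOf_forall_map_eq_and_nsmul_eq_zero hw hp
  let f : W.geomPoints → (((W.localMinimalIntegralModel v).map (algebraMap
      (v.adicCompletionIntegers K) (v.adicCompletion K))).baseChange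
        (AlgebraicClosure (v.adicCompletion K))).toAffine.Point :=
    fun m ↦ Φ (pointsMapOfEmb W ι m)
  have hf : Function.Injective f := fun a b hab ↦
    pointsMapOfEmb_injective W ι (Φ.injective hab)
  refine (hS.preimage hf.injOn).subset ?_
  rintro m ⟨hfix, k, hk⟩
  refine ⟨fun σ ↦ ?_, k, ?_⟩
  · change Affine.Point.map _ (Φ (pointsMapOfEmb W ι m)) = Φ (pointsMapOfEmb W ι m)
    rw [← transport_pointsMapOfEmb_smul hΦ]
    congr 2
    exact hfix _ (resGalOfEmb_closureEmb_mem_decomp v σ)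
  · change p ^ k • Φ (pointsMapOfEmb W ι m) = 0
    rw [← map_nsmul, ← map_nsmul, hk, map_zero, map_zero]

end Finite

end Summit.BirchSwinnertonDyer.Rank1Residual.X11b.AcSelmer

end
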